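import Summits.CriticalPhenomena.SAWScalingLimit.Theorems.SAWRestrictionRigidityLimitExistsTightUnique
import Summits.CriticalPhenomena.SAWScalingLimit.Theorems.SAWRestrictionRigidityLimitExistsPointwise
import Mathlib.MeasureTheory.Measure.HasOuterApproxClosed
import HarnessLib

/-!
# `LimitExists` (crux stmt-CriticalPhenomena-1371) — tightness plus OBSERVABLE-WISE convergence

Route `SAWRestrictionRigidity` of `CriticalPhenomena/SAWScalingLimit`; line `registered`
(`Cruxes/LimitExists/Lines/birth.lean`), lead c3.

`limitExists_iff_eventualTight_and_uniqueSubseqLimits` (p149315) isolates the content of the crux as eventual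
tightness (T) plus uniqueness of probability subsequential limits across endpoint approximations and mesh
sequences.  Here the uniqueness half is traded for a statement about NUMBERS only:

* **`limitExists_iff_eventualTight_and_forall_tendsto_integral`** — `LimitExists ↔ EventualTight ∧` for every
  Dobrushin domain, every endpoint approximation and every bounded continuous observable `f` of the curve class,
  the critical expectations `E_δ[f(γ)]` converge along `δ → 0⁺` to SOME real number.

No limit MEASURE is mentioned on the right: observable-wise limits along one approximation pin every
subsequential limit (limits in `ℝ` are unique), and they do not depend on the approximation (interleaving two
honest approximations on the irrational meshes, `isEndpointApprox_piecewise` + `eq_of_tendsto_piecewise'` of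
`…LimitExistsPointwise`), so
two probability subsequential limits have equal bounded continuous integrals and coincide
(`ext_of_forall_integral_eq_of_IsFiniteMeasure`).  Everything proved, standard axioms. [folklore]
-/

noncomputable section

open MeasureTheory Filter Topology Set Metric Function
open Literature.Probability.RandomPlanarGeometry Literature.Probability.RandomPlanarGeometry.SAW
open Literature.Probability.LatticeModels
open scoped ENNReal NNReal BoundedContinuousFunction Topology

namespace Summit.CriticalPhenomena.SAWScalingLimit.Theorems.SAWRestrictionRigidityLimitExists

open Summit.CriticalPhenomena.SAWScalingLimit.Theses.SAWRestrictionRigidity (LimitExists EventualTight)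

variable {D : DobrushinDomain}

/-- **Observable-wise limits are approximation-free.**  If along EVERY endpoint approximation of `D` the critical
expectation of the bounded continuous observable `f` converges along `δ → 0⁺`, then the limits `c` (along
`(a, b)`) and `c'` (along `(a', b')`) agree: interleave on the irrational meshes (`exists_interleavingSet`,
`isEndpointApprox_piecewise`) and read the interleaved limit from both strands. [folklore] -/
theorem observableLimit_eq {f : CurveClass ℂ →ᵇ ℝ}
    (hall : ∀ a'' b'' : ℝ → Site 2, IsEndpointApprox D a'' b'' → ∃ L : ℝ,
      Tendsto (fun δ => ∫ γ, f γ.curve ∂(law D.carrier δ (a'' δ) (b'' δ))) (𝓝[>] (0 : ℝ)) (𝓝 L))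
    {a b a' b' : ℝ → Site 2} (hab : IsEndpointApprox D a b) (hab' : IsEndpointApprox D a' b') {c c' : ℝ}
    (hc : Tendsto (fun δ => ∫ γ, f γ.curve ∂(law D.carrier δ (a δ) (b δ))) (𝓝[>] (0 : ℝ)) (𝓝 c))
    (hc' : Tendsto (fun δ => ∫ γ, f γ.curve ∂(law D.carrier δ (a' δ) (b' δ))) (𝓝[>] (0 : ℝ)) (𝓝 c')) :
    c = c' := by
  classical
  obtain ⟨S, hS, hS'⟩ := exists_interleavingSet
  obtain ⟨c'', hc''⟩ := hall _ _ (isEndpointApprox_piecewise S hab hab')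
  have h₁ : c = c'' :=
    eq_of_tendsto_piecewise' (g := fun δ x y => ∫ γ, f γ.curve ∂(law D.carrier δ x y)) hS hc hc''
  have h₂ : c' = c'' := by
    have e₁ : Sᶜ.piecewise a' a = S.piecewise a a' := Set.piecewise_compl S a' a
    have e₂ : Sᶜ.piecewise b' b = S.piecewise b b' := Set.piecewise_compl S b' b
    exact eq_of_tendsto_piecewise' (g := fun δ x y => ∫ γ, f γ.curve ∂(law D.carrier δ x y))
      (S := Sᶜ) (a := a') (b := b') (a' := a) (b' := b) hS' hc' (by rw [e₁, e₂]; exact hc'')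
  exact h₁.trans h₂.symm

/-- **Observable-wise limits pin subsequential limits.**  If along every endpoint approximation of `D` every
bounded continuous observable has a limit along `δ → 0⁺`, then two probability weak limits `ν, ν'` of the pushed
critical SAW laws along two endpoint approximations and two mesh sequences `s, s' → 0⁺` are equal: for each
`f`, `∫ f dν` and `∫ f dν'` are the observable-wise limits along `(a, b)` and `(a', b')` (limits in `ℝ` are
unique), which agree (`observableLimit_eq`); finite Borel measures on the metric curve space with equal bounded
continuous integrals coincide. [folklore] -/
theorem eq_of_subseqLimits_of_observableLimits
    (hall : ∀ a'' b'' : ℝ → Site 2, IsEndpointApprox D a'' b'' → ∀ f : CurveClass ℂ →ᵇ ℝ, ∃ L : ℝ,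
      Tendsto (fun δ => ∫ γ, f γ.curve ∂(law D.carrier δ (a'' δ) (b'' δ))) (𝓝[>] (0 : ℝ)) (𝓝 L))
    {a b a' b' : ℝ → Site 2} (hab : IsEndpointApprox D a b) (hab' : IsEndpointApprox D a' b')
    {s s' : ℕ → ℝ} {ν ν' : Measure (CurveClass ℂ)}
    (hs : Tendsto s atTop (𝓝[>] (0 : ℝ))) (hs' : Tendsto s' atTop (𝓝[>] (0 : ℝ)))
    [IsProbabilityMeasure ν] [IsProbabilityMeasure ν']
    (hlim : ∀ f : CurveClass ℂ →ᵇ ℝ, Tendsto (fun n => ∫ γ, f γ.curve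
      ∂(law D.carrier (s n) (a (s n)) (b (s n)))) atTop (𝓝 (∫ x, f x ∂ν)))
    (hlim' : ∀ f : CurveClass ℂ →ᵇ ℝ, Tendsto (fun n => ∫ γ, f γ.curve
      ∂(law D.carrier (s' n) (a' (s' n)) (b' (s' n)))) atTop (𝓝 (∫ x, f x ∂ν'))) : ν = ν' := by
  refine ext_of_forall_integral_eq_of_IsFiniteMeasure fun f => ?_
  obtain ⟨c, hc⟩ := hall a b hab f
  obtain ⟨c', hc'⟩ := hall a' b' hab' f
  have h₁ : ∫ x, f x ∂ν = c := tendsto_nhds_unique (hlim f) (hc.comp hs)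
  have h₂ : ∫ x, f x ∂ν' = c' := tendsto_nhds_unique (hlim' f) (hc'.comp hs')
  rw [h₁, h₂]
  exact observableLimit_eq (fun a'' b'' h'' => hall a'' b'' h'' f) hab hab' hc hc'

/-- **`LimitExists ↔ EventualTight ∧ (observable-wise convergence)`.**  The critical `δℤ²` SAW laws have a
full scaling limit as a chordal curve family IF AND ONLY IF they are eventually tight (item
stmt-CriticalPhenomena-1372) AND for every Dobrushin domain, every endpoint approximation and every bounded
continuous observable `f` of the curve class the expectations `E_δ[f(γ)]` converge along `δ → 0⁺` to some real
number.  Forward: `eventualTight_of_limitExists` (p148374) and the limit law; backward: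
`limitExists_iff_eventualTight_and_uniqueSubseqLimits` (p149315) with the uniqueness of probability subsequential
limits supplied by `eq_of_subseqLimits_of_observableLimits`. [folklore] -/
theorem limitExists_iff_eventualTight_and_forall_tendsto_integral : Summit.CriticalPhenomena.SAWScalingLimit.Theses.SAWRestrictionRigidity.LimitExists ↔ (Summit.CriticalPhenomena.SAWScalingLimit.Theses.SAWRestrictionRigidity.EventualTight ∧ ∀ (D : Literature.Probability.RandomPlanarGeometry.DobrushinDomain) (a b : ℝ → Literature.Probability.LatticeModels.Site 2), Literature.Probability.RandomPlanarGeometry.SAW.IsEndpointApprox D a b → ∀ f : BoundedContinuousFunction (Literature.Probability.RandomPlanarGeometry.CurveClass ℂ) ℝ, ∃ L : ℝ, Filter.Tendsto (fun δ => ∫ γ, f γ.curve ∂(Literature.Probability.RandomPlanarGeometry.SAW.law D.carrier δ (a δ) (b δ))) (nhdsWithin 0 (Set.Ioi 0)) (nhds L)) := by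
  constructor
  · intro h
    refine ⟨eventualTight_of_limitExists h, ?_⟩
    obtain ⟨P, -, hP⟩ := h
    intro D a b hab f
    exact ⟨∫ x, f x ∂(P D), by simpa only [id_eq] using hP D a b hab f⟩
  · rintro ⟨hT, hO⟩
    refine limitExists_iff_eventualTight_and_uniqueSubseqLimits.2 ⟨hT, ?_⟩
    intro D a b a' b' hab hab' s s' ν ν' hs hs' hν hν' hlim hlim'
    exact eq_of_subseqLimits_of_observableLimits (hO D) hab hab' hs hs' hlim hlim'

end Summit.CriticalPhenomena.SAWScalingLimit.Theorems.SAWRestrictionRigidityLimitExists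

end
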